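import Summits.CriticalPhenomena.PercolationContinuityZ3.Theorems.PercNearOneGluingNoHeavyQuantFarCycleBlockTransfer
import Summits.CriticalPhenomena.PercolationContinuityZ3.Theorems.PercNearOneGluingNoHeavyQuantFarHubFamilyTransfer
import HarnessLib

/-!
# QUANT lane R8, front "FAR beyond trees", layer one — the pendant CYCLE as an instance of the hub-family interface: the domination hypothesis
# `hdom` of `Block.farLayerOne_hubFamily` is DISCHARGED for cycles by `TwoChain.cycDec` (consistency / non-vacuity of the interface)

builds on p205010 (kernel theorem, internal audit signed; external expert review pending)

Support file (`--supports stmt-CriticalPhenomena-4575`), seat `prim-quant-p1` (gen 22); memo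
`run/shared/lean/prim/quant/prim-quant-p1-g22/FOR-LEAD-KHUB.md` §6.  Standard axioms; no sorries; no definitions.

* `Block.loadedList_eq_floadedList` — the two loaded lists agree for `J = cpos L`, `v = cyc`;
* `TwoChain.hProd_tProd_congr` — `hProd n`, `tProd n` only depend on `m i, u i, s i, d i`, `1 ≤ i ≤ n`;
* `Block.decChain_agrees_chainOf` — the chain of core marginals of the cycle's hub family has the same `m, u, s, d` as the two-chain of the cycle
  (`m_j = P_w(c ↔ cyc j in core) = a_j ⊕ b_j`);
* **`Block.cycleBlock_hdom`** — the hypothesis `hdom` of `…QuantFarHubFamilyTransfer` holds for every pendant cycle block (by `TwoChain.cycDec` and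
  the identification `P_w(X ≥ 1) = hh`, `P_w(X ≥ 2) = tt` of `…QuantFarCycleBlockTransfer`);
* `Block.farLayerOne_cycleBlock_viaFamily` — the k-hub transfer re-derived through the general interface (with `Block.fdecouple`).
[this work]
-/

noncomputable section

namespace Summit.CriticalPhenomena.PercolationContinuityZ3.Theorems

namespace Quant

namespace Block

open Finset MeasureTheory Set
open Literature.Probability.LatticeModels
open Literature.Probability.Percolation
open Summit.CriticalPhenomena.PercolationContinuityZ3.Theorems.HairyCycle (RC)
open TwoChain (hProd tProd hh tt)
open scoped Classical

variable {n : ℕ}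

/-- `hProd n` and `tProd n` only depend on `m i, u i, s i, d i` for `1 ≤ i ≤ n`. [this work] -/
theorem _root_.Summit.CriticalPhenomena.PercolationContinuityZ3.Theorems.Quant.Block.TwoChain.hProd_tProd_congr :
    ∀ (N : ℕ) (C C' : TwoChain), (∀ i, 1 ≤ i → i ≤ N → C.m i = C'.m i ∧ C.u i = C'.u i ∧ C.s i = C'.s i ∧ C.d i = C'.d i) →
      hProd N C = hProd N C' ∧ tProd N C = tProd N C' := by
  intro N
  induction N with
  | zero => intro C C' _; simp
  | succ k ih =>
    intro C C' h
    obtain ⟨hm, hu, hs, hd⟩ := h 1 le_rfl (by omega)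
    have h' : ∀ i, 1 ≤ i → i ≤ k → C.shift.m i = C'.shift.m i ∧ C.shift.u i = C'.shift.u i ∧ C.shift.s i = C'.shift.s i ∧ C.shift.d i = C'.shift.d i := by
      intro i hi1 hik
      rw [TwoChain.shift_m, TwoChain.shift_m, TwoChain.shift_u, TwoChain.shift_u, TwoChain.shift_s, TwoChain.shift_s, TwoChain.shift_d,
        TwoChain.shift_d]
      exact h (i + 1) (by omega) (by omega)
    obtain ⟨ih1, ih2⟩ := ih C.shift C'.shift h'
    rw [TwoChain.hProd_succ, TwoChain.hProd_succ, TwoChain.tProd_succ, TwoChain.tProd_succ, hm, hu, hs, hd, ih1, ih2]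
    exact ⟨rfl, rfl⟩

section CycleBlock

variable {L : ℕ} {cyc : ℕ → Fin n} {S : ℕ → Finset (Fin n)} {Z : Finset (Fin n)} (H : IsCycleBlock L cyc S Z)
  (w : Sym2 (Fin n) → unitInterval) (hw : CycleHang L cyc S Z w) (A : Finset (Fin n))

/-- The loaded list of the cycle is the loaded list of its hub family. [this work] -/
theorem loadedList_eq_floadedList : loadedList L cyc S A = floadedList (cpos L) cyc S A := by
  refine List.SortedLT.eq_of_mem_iff ?_ ?_ fun j => ?_
  · exact List.sortedLT_iff_pairwise.2 (loadedList_sorted L cyc S A)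
  · refine List.sortedLT_iff_pairwise.2 ((List.sortedLT_iff_pairwise.1 (Finset.sortedLT_sort _)).filter _)
  · rw [mem_loadedList, mem_floadedList, mem_cpos]; tauto

include H hw in
/-- The chain of core marginals of the cycle's hub family agrees with the two-chain of the cycle in `m, u, s, d` (`1 ≤ i ≤ N`). [this work] -/
theorem decChain_agrees_chainOf : ∀ i, 1 ≤ i → i ≤ (loadedList L cyc S A).length →
    (decChain (cyc 0) Z (cpos L) cyc S A w).m i = (chainOf L cyc S A w 0 (loadedList L cyc S A)).m i ∧
    (decChain (cyc 0) Z (cpos L) cyc S A w).u i = (chainOf L cyc S A w 0 (loadedList L cyc S A)).u i ∧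
    (decChain (cyc 0) Z (cpos L) cyc S A w).s i = (chainOf L cyc S A w 0 (loadedList L cyc S A)).s i ∧
    (decChain (cyc 0) Z (cpos L) cyc S A w).d i = (chainOf L cyc S A w 0 (loadedList L cyc S A)).d i := by
  intro i hi1 hiN
  obtain ⟨k, rfl⟩ : ∃ k, i = k + 1 := ⟨i - 1, by omega⟩
  have hk : k < (loadedList L cyc S A).length := by omega
  set p := (loadedList L cyc S A)[k] with hpdef
  have hp : 1 ≤ p ∧ p < L := loadedList_bound L cyc S A p (List.getElem_mem hk)
  have hpos : lpos L 0 (loadedList L cyc S A) (k + 1) = p := lpos_of_lt_length hk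
  have hpos' : lpos 0 0 (floadedList (cpos L) cyc S A) (k + 1) = p := by rw [← loadedList_eq_floadedList]; exact lpos_of_lt_length hk
  unfold decChain
  refine ⟨?_, ?_, ?_, ?_⟩
  · rw [mchain_m, hpos']
    simp only [TwoChain.m, chainOf, hpos]
    rw [real_coreReach_cyc_eq H hw hp.2, real_RC w H hp.2.le]
  · simp only [TwoChain.u, mchain, chainOf, hpos, hpos']
  · simp only [mchain, chainOf, hpos, hpos']
  · simp only [mchain, chainOf, hpos, hpos']

include H hw in
/-- **The domination hypothesis of the hub-family interface holds for every pendant cycle block** (by `TwoChain.cycDec`). [this work] -/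
theorem cycleBlock_hdom : ∀ q : ℝ, 0 ≤ q →
    (∀ i, i < (floadedList (cpos L) cyc S A).length →
      q ≤ (decChain (cyc 0) Z (cpos L) cyc S A w).m (i + 1) * (decChain (cyc 0) Z (cpos L) cyc S A w).u (i + 1)) →
    ∃ l : ℝ, 0 ≤ l ∧ l ≤ 1 ∧
      l * hProd (floadedList (cpos L) cyc S A).length (decChain (cyc 0) Z (cpos L) cyc S A w) + (1 - l) * q ≤
        (prodBernoulli w).real {ω | 1 ≤ ((A ∩ Z).filter fun a => onZ Z ω ∈ openConn (cyc 0) a).card} ∧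
      l * tProd (floadedList (cpos L) cyc S A).length (decChain (cyc 0) Z (cpos L) cyc S A w) + (1 - l) * q ≤
        (prodBernoulli w).real {ω | 2 ≤ ((A ∩ Z).filter fun a => onZ Z ω ∈ openConn (cyc 0) a).card} := by
  intro q hq0 hq
  set ps := loadedList L cyc S A with hps
  set C := chainOf L cyc S A w 0 ps with hC
  have hV : C.Valid ps.length :=
    chainOf_valid w A (loadedList_sorted L cyc S A) (fun p _ => Nat.zero_le p) (fun p hp => (loadedList_bound L cyc S A p hp).2.le) (Nat.zero_le L)
  have hlen : (floadedList (cpos L) cyc S A).length = ps.length := by rw [hps, loadedList_eq_floadedList]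
  obtain ⟨e1, e2⟩ := TwoChain.hProd_tProd_congr ps.length (decChain (cyc 0) Z (cpos L) cyc S A w) C (decChain_agrees_chainOf H w hw A)
  have hq' : ∀ i, i < ps.length → q ≤ C.m (i + 1) * C.u (i + 1) := by
    intro i hi
    obtain ⟨hm, hu, -, -⟩ := decChain_agrees_chainOf H w hw A (i + 1) (by omega) (by rw [← hps]; omega)
    rw [← hm, ← hu]
    exact hq i (by rw [hlen]; exact hi)
  obtain ⟨l, hl0, hl1, h1, h2⟩ := TwoChain.cycDec ps.length C hV q hq0 hq'
  refine ⟨l, hl0, hl1, ?_, ?_⟩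
  · rw [hlen, e1, real_blockCount_ge_one H w hw A]; exact h1
  · rw [hlen, e2, real_blockCount_ge_two H w hw A]; exact h2

include H hw in
/-- **The k-hub transfer through the general interface**: the layer-one FAR instance transfers from the hub-decoupled weights `Block.fdecouple` of the
cycle's hub family. [this work] -/
theorem farLayerOne_cycleBlock_viaFamily {o : Fin n} (ho : o ∉ Z) (hAZ : (A ∩ Z).Nonempty) (t : ℝ)
    (hfar' : (2 : ℝ) < ∑ a ∈ A, (prodBernoulli (fdecouple (cyc 0) Z (cpos L) cyc S w)).real (openConn o a) →
      (∀ a ∈ A, (prodBernoulli (fdecouple (cyc 0) Z (cpos L) cyc S w)).real (openConn o a)ᶜ ≤ t) →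
      (prodBernoulli (fdecouple (cyc 0) Z (cpos L) cyc S w)).real {ω : BondConfig (Fin n) | (A.filter fun a => ω ∈ openConn o a).card ≤ 1} ≤ t)
    (hsum : (2 : ℝ) < ∑ a ∈ A, (prodBernoulli w).real (openConn o a))
    (hcut : ∀ a ∈ A, (prodBernoulli w).real (openConn o a)ᶜ ≤ t) :
    (prodBernoulli w).real {ω : BondConfig (Fin n) | (A.filter fun a => ω ∈ openConn o a).card ≤ 1} ≤ t :=
  farLayerOne_hubFamily (isHubFamily H) w A (fun j hj => hw.hangS j (mem_cpos.1 hj).1 (mem_cpos.1 hj).2) hw.hangZ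
    (fun a ha => by
      obtain ⟨j, hj1, hjL, h⟩ := H.Zsub a (Finset.mem_inter.1 ha).2
      exact ⟨j, mem_cpos.2 ⟨hj1, hjL⟩, h⟩)
    ho hAZ t (cycleBlock_hdom H w hw A) hfar' hsum hcut

end CycleBlock

end Block

end Quant

end Summit.CriticalPhenomena.PercolationContinuityZ3.Theorems
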